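import Summits.HodgeConjecture.HodgeConjecture.Theorems.MarkmanPartnerTransportPicardThreeK3SquaresZeta11Type
import Literature.AlgebraicGeometry.Surfaces.K3RealMultiplicationZeta9OpenFamily
import HarnessLib

/-!
# Route MarkmanPartnerTransport · crux `PicardThreeK3Squares` (stmt-HodgeConjecture-19652) —
# HC⁴(S ⊗ S) for every K3 surface of the ζ₉ real-multiplication type (Picard number 10)

Cell hodge-nonav, crux #4 (HC⁴(S ⊗ S) for projective K3 surfaces with `ρ(S) ≥ 3`; open core: real
multiplication), INDEX row M-θ₉ (planner memo ROUTE-P1AI §A.5): the van Geemen–Schütt ζ₉ family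
(Forum Math. Sigma 13 (2025) e2, Thm. 1.1 (9), §4.8, §5.6; CM anchor = the D2 family of
Artebani–Comparin–Valdés, Comm. Algebra 48 (2020), Ex. 3.5) has Picard number `10` — INSIDE the crux's
open Picard list `{4, 6, 7, 8, 10, 12, 13, 14, 16}` — and real multiplication by the CUBIC field
`ℚ(ζ₉ + ζ₉⁻¹)`. It is typed as the ∃-form open-period-set fact
`VanGeemenSchuett2025_zeta9_cycleOnOpenPeriodSet` (`Literature/…/K3RealMultiplicationZeta9OpenFamily`)
and plugged into (T‴) `RMTypeOrbit.hodgeConjectureFor_square_of_exists_on_open_at_of_isK3Surface`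
(prover seat hodge-nonav-19652-p1 gen 10: rational orbit density + Buskin transport). Prover seat
hodge-nonav-19652-p1 gen 12; `--supports stmt-HodgeConjecture-19652`, helper. CONDITIONAL on the two
named facts `Buskin2019_hodgeIsometry_algebraic` and `VanGeemenSchuett2025_zeta9_cycleOnOpenPeriodSet`
ONLY; credits nothing; nothing here says HC is proved.

* `k3Form_pow_left_eq_pow_right` — for a `k3Form`-isometry `g` with `g⁹ = 1` and `k + m = 9`:
  `((gᵏ a) . b) = (a . gᵐ b)` (the adjoint of `gᵏ` is `g⁻ᵏ = g^{9-k}`).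
* `selfAdjoint_of_zeta9Model` — the model endomorphism `θ_ℂ = ⅓(2g + 2g⁸ - g² - g⁴ - g⁵ - g⁷)`
  (`= (g + g⁻¹) ∘ P_T`, `P_T = -⅓(g³ - 1)(g³ + 2)` the projector onto the primitive part
  `T = ker Φ₉(g)` along the cube-fixed part) of an order-`9` isometry `g` is `k3Form`-self-adjoint:
  the formula is symmetric under `k ↦ 9 - k`.
* `two_mul_cos_two_pi_div_nine_pos` — `e₀ = 2cos(2π/9) > 0`.
* `hodgeConjectureFor_square_of_zeta9Model_of_open` — (T‴) specialised to a ζ₉ datum `(g, y₀, θ)`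
  GIVEN the open-set input for `θ` at `e₀` (the reusable `∀`-datum form: no located family is assumed;
  mod Buskin only).
* **`exists_zeta9Type_hodgeConjectureFor_square`** — THERE IS a ζ₉ datum `(g, y₀, θ)` (an integral
  isometry `g` of the K3 lattice with `g⁹ = 1` and cube-fixed part of rank `10`, a period point `y₀`
  with `g y₀ = e^{2πi/9} y₀`, and its model endomorphism `θ`) such that EVERY projective K3 surface
  `S` marked by `(η, p, x)` carrying an endomorphism `t` of `H²(S(ℂ); ℂ)` (rational, type-preserving,
  killing `N¹`, image `⊥ N¹`, `P(t) = 0` on `T` for a separable `P` with `P(0) ≠ 0`, generating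
  `End_Hdg T(S)`) that is conjugate by a RATIONAL ISOMETRY `σ` of `Λ_ℚ` to `θ_ℂ` (`σ η t = θ_ℂ σ η`)
  satisfies `HodgeConjectureFor 4 (S ⊗ S)`. In words: HC⁴ of the square of every K3 surface whose
  rational real-multiplication type is that of a member of the maximal ζ₉ family — by
  `RMTypeOrbit.exists_isogenous_markedK3_mem_of_isOpen`, exactly the K3 surfaces RM-isogenous to a
  member (all of Picard number `10`, `End_Hdg T(S) ⊇ ℚ(ζ₉ + ζ₉⁻¹)` cubic); the members themselves are
  the case `σ ∈ O(Λ)`. The `∃` is over the datum because the fact is an existence statement (no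
  printed theorem locates every order-`9` lattice datum of Picard rank `10` in the D2 family — see the
  fact's docstring; by Landherr's Hasse principle for hermitian forms over `ℚ(ζ₉)/ℚ(ζ₉)⁺`, NOT
  formalised, all such data have `O(Λ_ℚ)`-conjugate `θ`, so the rational type is in fact unique).
* `exists_zeta9Type_hodgeConjectureFor_hilbertSquare` — the same for every Hilbert square `S^{[2]}`
  of such an `S` (`ρ(S^{[2]}) = 11`; blow up the diagonal, descend along `B_Δ(S × S) → S^{[2]}`;
  + `Beauville1983_hilbertSquare_blowupDiagonal_surjection`).
* APPENDED (same seat): `thetaC_apply_eq_of_zeta9Model` — the datum's own period lies on the Hodge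
  locus, `θ_ℂ y₀ = 2cos(2π/9) · y₀` (the cyclotomic identity `⅓(2ζ + 2ζ⁸ - ζ² - ζ⁴ - ζ⁵ - ζ⁷) = ζ + ζ⁻¹`,
  certifying the eigenvalue bookkeeping of the model endomorphism), and
  `aeval_two_mul_cos_two_pi_div_nine_eq_zero` — `e₀ = 2cos(2π/9)` is a root of `X³ - 3X + 1`, the
  polynomial of `VanGeemenSchuett2025_rmK3_cycleInduced_zeta9` (the RM field of the type is the cubic
  `ℚ(ζ₉ + ζ₉⁻¹)`). Both fact-free.

No definition, no sorry.

References: van Geemen–Schütt, Forum Math. Sigma 13 (2025) e2, Thm. 1.1 (9), §4.5–4.8, §5.6;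
Artebani–Comparin–Valdés, Comm. Algebra 48 (2020) 3661–3672, Thm. 1, Prop. 2.2, Ex. 3.5; Buskin,
J. reine angew. Math. 755 (2019), Thm. 1.1; Huybrechts, *Lectures on K3 Surfaces*, Ch. 3 Cor. 3.6,
Ch. 6 Prop. 1.5, Ch. 7 Thm. 5.3.
-/

set_option linter.dupNamespace false

noncomputable section

namespace Summit.HodgeConjecture.HodgeConjecture.Theorems.MarkmanPartnerTransport.RMTypeOrbit

open CategoryTheory MonoidalCategory Polynomial
open Literature.AlgebraicGeometry Literature.AlgebraicGeometry.Motives Literature.AlgebraicGeometry.HodgeTheory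
open Literature.AlgebraicGeometry.Surfaces Literature.LinearAlgebra.QuadraticForm
open Literature.AlgebraicGeometry.Hyperkaehler Literature.AlgebraicGeometry.HilbertScheme
open Literature.AlgebraicTopology.SingularHomology
open Summit.HodgeConjecture.HodgeConjecture.Theorems.NikulinTwinTransport
open Summit.HodgeConjecture.HodgeConjecture.Theorems.MarkmanPartnerTransport.IsogenyInvariance
open Summit.HodgeConjecture.HodgeConjecture.Theorems.MarkmanPartnerTransport.RMTypeDescent

/-- `MarkedK3[S, η, p, x]`: VERBATIM the `let MarkedK3 := …` binder of the route declaration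
`PicardThreeK3Squares` (as in `…RMTypeDescent`). Local notation only. -/
local notation3 (prettyPrint := false) "MarkedK3[" S ", " η ", " p ", " x "]" =>
  (p ≠ 0 ∧ (IsIntegralClass p ∧
    (∀ q : complexBetti S (2 * 2), IsIntegralClass q → ∃ n : ℤ, q = n • p) ∧
    (∀ c : complexBetti S (2 * 1), IsIntegralClass c ↔ ∃ v : K3Index → ℤ, η c = fun i => (v i : ℂ)) ∧
    (∀ a b : complexBetti S (2 * 1),
      cupProduct (rfl : 2 * 1 + 2 * 1 = 2 * 2) a b = k3Form (η a) (η b) • p) ∧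
    IsOfHodgeType 2 S (2 * 1) 2 0 (LinearEquiv.symm η x) ∧
    (∀ τ : complexBetti S (2 * 1), IsOfHodgeType 2 S (2 * 1) 2 0 τ →
      ∃ t : ℂ, τ = t • LinearEquiv.symm η x)) ∧
    (k3Form x x = 0 ∧ 0 < (k3Form (star x) x).re ∧
      ∃ u : K3Index → ℤ, k3Form (fun i => (u i : ℂ)) x = 0 ∧ 0 < ∑ i, ∑ j, u i * k3Gram i j * u j))

/-- `Zeta9Model[g, y₀, θ]`: VERBATIM the datum conjuncts of the named fact
`VanGeemenSchuett2025_zeta9_cycleOnOpenPeriodSet` — `g` is an integral `k3Form`-isometry of `Λ_ℂ`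
with `g⁹ = 1` whose cube-fixed part `ker(g³ - 1)` has dimension `10` (Picard number `10`), `y₀` is a
period point in its `e^{2πi/9}`-eigenspace, and `θ ∈ M₂₂(ℚ)` is the model real-multiplication
endomorphism `θ_ℂ = ⅓(2g + 2g⁸ - g² - g⁴ - g⁵ - g⁷) = (g + g⁻¹) ∘ P_T`. Local notation only. -/
local notation3 (prettyPrint := false) "Zeta9Model[" g ", " y₀ ", " θ "]" =>
  ((∀ a b : K3Index → ℂ, k3Form (g a) (g b) = k3Form a b) ∧
    (∀ v : K3Index → ℤ, ∃ w : K3Index → ℤ,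
      g (fun i => ((v i : ℤ) : ℂ)) = fun i => ((w i : ℤ) : ℂ)) ∧
    g ^ 9 = 1 ∧
    Module.finrank ℂ (LinearMap.ker (g ^ 3 - 1)) = 10 ∧
    k3Form y₀ y₀ = 0 ∧ 0 < (k3Form (star y₀) y₀).re ∧
    g y₀ = Complex.exp (2 * Real.pi * Complex.I / 9) • y₀ ∧
    (∀ y : K3Index → ℂ, thetaC θ y =
      (1 / 3 : ℂ) • ((2 : ℂ) • g y + (2 : ℂ) • (g ^ 8) y - (g ^ 2) y - (g ^ 4) y - (g ^ 5) y
        - (g ^ 7) y)))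

/-- `CycleEx[θ, e, U]`: the ∃-form cycle clause of (T‴) (`…RMTypeOpenSingleEigenvalue`) — at every
`θ`-generic period point of `D_{θ,e}` in `U` there EXISTS a marked projective K3 surface carrying an
algebraic class inducing `η'⁻¹ θ_ℂ η'`. Local notation only. -/
local notation3 (prettyPrint := false) "CycleEx[" θ ", " e ", " U "]" =>
  (∀ y : K3Index → ℂ, y ∈ U → thetaC θ y = (e : ℂ) • y → k3Form y y = 0 → 0 < (k3Form (star y) y).re →
    (∀ v : K3Index → ℚ, k3Form (fun i => (v i : ℂ)) y = 0 → Matrix.mulVec θ v = 0) →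
    ∃ (S' : SchemeOver ℂ) (hS' : IsK3Surface S') (η' : complexBetti S' (2 * 1) ≃ₗ[ℂ] (K3Index → ℂ))
      (p' : complexBetti S' (2 * 2)), MarkedK3[S', η', p', y] ∧
      ∃ γ' ∈ algebraicClasses (S' ⊗ S') 2, ∀ z : complexBetti S' (2 * 1),
        (η'.symm.toLinearMap ∘ₗ (thetaC θ ∘ₗ η'.toLinearMap)) z =
          complexGysin complexOrientationFamily
            (IsSmoothProjective.tensor_holds hS'.isSmoothProjective hS'.isSmoothProjective)
            hS'.isSmoothProjective (SemiCartesianMonoidalCategory.fst S' S')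
            (rfl : 2 * 1 + 2 * 2 + 2 * 2 = 2 * 1 + 2 * (2 + 2))
            (cupProduct (rfl : 2 * 1 + 2 * 2 = 2 * 1 + 2 * 2)
              (complexBetti.map (SemiCartesianMonoidalCategory.snd S' S') (2 * 1) z) γ'))

/-- `SquareHC[θ]`: **every K3 surface of rational real-multiplication type `θ` has HC⁴(S ⊗ S)** —
VERBATIM the `S`-side binders and conclusion of (T‴)
`hodgeConjectureFor_square_of_exists_on_open_at_of_isK3Surface`: a marked projective K3 surface
`(S, η, p, x)` with an endomorphism `t` of `H²(S(ℂ); ℂ)` — rational, Hodge-type preserving, killing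
`N¹H²`, with image cup-orthogonal to `N¹H²`, annihilated on `T(S)` by a separable `P ∈ ℚ[X]` with
`P(0) ≠ 0`, generating `End_Hdg T(S)` — conjugate to `θ_ℂ` by a rational isometry `σ` of `Λ_ℚ`
satisfies `HodgeConjectureFor 4 (S ⊗ S)`. Local notation only. -/
local notation3 (prettyPrint := false) "SquareHC[" θ "]" =>
  (∀ (S : SchemeOver ℂ) (_hS : IsK3Surface S) (P : ℚ[X]) (_hPsep : P.Separable) (_hP0 : P.eval 0 ≠ 0)
    (η : complexBetti S (2 * 1) ≃ₗ[ℂ] (K3Index → ℂ)) (p : complexBetti S (2 * 2)) (x : K3Index → ℂ)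
    (_hM : MarkedK3[S, η, p, x])
    (t : complexBetti S (2 * 1) →ₗ[ℂ] complexBetti S (2 * 1))
    (_ht_rat : ∀ y, IsRationalClass y → IsRationalClass (t y))
    (_ht_typ : ∀ (i j : ℕ) (y : complexBetti S (2 * 1)),
      IsOfHodgeType 2 S (2 * 1) i j y → IsOfHodgeType 2 S (2 * 1) i j (t y))
    (_ht_N : ∀ d ∈ algebraicClasses S 1, t d = 0)
    (_ht_perp : ∀ (y : complexBetti S (2 * 1)), ∀ d ∈ algebraicClasses S 1,
      cupProduct (rfl : 2 * 1 + 2 * 1 = 2 * 2) (t y) d = 0)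
    (_hP : IsAnnihilatedOnTranscendentalBy S t P) (_hgen : TranscendentalEndomorphismsGeneratedBy S t)
    (σ : Module.End ℂ (K3Index → ℂ)) (_hσ : ∀ a b, k3Form (σ a) (σ b) = k3Form a b)
    (_hσrat : ∀ v : K3Index → ℤ, ∃ w : K3Index → ℚ, σ (fun i => (v i : ℂ)) = fun i => (w i : ℂ))
    (_hconj : ∀ c : complexBetti S (2 * 1), σ (η (t c)) = thetaC θ (σ (η c))),
    HodgeConjectureFor 4 (S ⊗ S))

variable {S : SchemeOver ℂ}

/-- For a `k3Form`-isometry `g` of `Λ_ℂ` with `g⁹ = 1` and `k + m = 9`: `((gᵏ a) . b) = (a . (gᵐ b))` —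
the adjoint of `gᵏ` is `g⁻ᵏ = gᵐ`. [folklore] -/
theorem k3Form_pow_left_eq_pow_right {g : Module.End ℂ (K3Index → ℂ)}
    (hg : ∀ a b : K3Index → ℂ, k3Form (g a) (g b) = k3Form a b) (hg9 : g ^ 9 = 1)
    {k m : ℕ} (hkm : k + m = 9) (a b : K3Index → ℂ) :
    k3Form ((g ^ k) a) b = k3Form a ((g ^ m) b) := by
  rw [← k3Form_pow_pow_of_isometry hg m ((g ^ k) a) b, ← Module.End.mul_apply, ← pow_add,
    show m + k = 9 by omega, hg9, Module.End.one_apply]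

/-- **The ζ₉ model endomorphism is self-adjoint.** If `g` is a `k3Form`-isometry of `Λ_ℂ` with
`g⁹ = 1` and `θ_ℂ = ⅓(2g + 2g⁸ - g² - g⁴ - g⁵ - g⁷)` (`= (g + g⁻¹) ∘ P_T`, the model of
`σ₀^* + (σ₀^*)⁻¹` on the primitive part, extended by `0` on the cube-fixed part), then
`(θ_ℂ a . b) = (a . θ_ℂ b)`: the adjoint of `gᵏ` is `g^{9-k}` and the formula is symmetric under
`k ↦ 9 - k`. This is the self-adjointness antecedent of the RM-type descent theorems.
[cite: GeemenSchutt2023, §2.1 (adjoint property) and §4.8] -/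
theorem selfAdjoint_of_zeta9Model {g : Module.End ℂ (K3Index → ℂ)} {θ : Matrix K3Index K3Index ℚ}
    (hg : ∀ a b : K3Index → ℂ, k3Form (g a) (g b) = k3Form a b) (hg9 : g ^ 9 = 1)
    (hθ : ∀ y : K3Index → ℂ, thetaC θ y =
      (1 / 3 : ℂ) • ((2 : ℂ) • g y + (2 : ℂ) • (g ^ 8) y - (g ^ 2) y - (g ^ 4) y - (g ^ 5) y
        - (g ^ 7) y)) (a b : K3Index → ℂ) :
    k3Form (thetaC θ a) b = k3Form a (thetaC θ b) := by
  have h1 : k3Form (g a) b = k3Form a ((g ^ 8) b) := by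
    simpa using k3Form_pow_left_eq_pow_right hg hg9 (k := 1) (m := 8) rfl a b
  have h8 : k3Form ((g ^ 8) a) b = k3Form a (g b) := by
    simpa using k3Form_pow_left_eq_pow_right hg hg9 (k := 8) (m := 1) rfl a b
  have h2 : k3Form ((g ^ 2) a) b = k3Form a ((g ^ 7) b) :=
    k3Form_pow_left_eq_pow_right hg hg9 (k := 2) (m := 7) rfl a b
  have h7 : k3Form ((g ^ 7) a) b = k3Form a ((g ^ 2) b) :=
    k3Form_pow_left_eq_pow_right hg hg9 (k := 7) (m := 2) rfl a b
  have h4 : k3Form ((g ^ 4) a) b = k3Form a ((g ^ 5) b) :=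
    k3Form_pow_left_eq_pow_right hg hg9 (k := 4) (m := 5) rfl a b
  have h5 : k3Form ((g ^ 5) a) b = k3Form a ((g ^ 4) b) :=
    k3Form_pow_left_eq_pow_right hg hg9 (k := 5) (m := 4) rfl a b
  rw [hθ a, hθ b]
  simp only [k3Form_sub_left, k3Form_add_left, k3Form_smul_left, k3Form_sub_right', k3Form_add_right,
    k3Form_smul_right]
  rw [h1, h8, h2, h7, h4, h5]
  ring

/-- `2cos(2π/9) > 0` (`0 < 2π/9 < π/2`). [folklore] -/
theorem two_mul_cos_two_pi_div_nine_pos : 0 < 2 * Real.cos (2 * Real.pi / 9) := by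
  have h : 0 < Real.cos (2 * Real.pi / 9) := by
    apply Real.cos_pos_of_mem_Ioo
    constructor <;> nlinarith [Real.pi_pos]
  linarith

/-- **(T‴) for a ζ₉ datum, GIVEN the open-set input.** Let `(g, y₀, θ)` be a ζ₉ datum (integral
isometry `g` of the K3 lattice, `g⁹ = 1`, cube-fixed part of rank `10`, period point `y₀` with
`g y₀ = e^{2πi/9} y₀`, model endomorphism `θ_ℂ = ⅓(2g + 2g⁸ - g² - g⁴ - g⁵ - g⁷)`), and suppose `θ`
is cycle-induced (∃-form) on an open `U ⊂ Λ_ℂ` meeting the Hodge locus `D_{θ,e₀}`, `e₀ = 2cos(2π/9)`.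
Then every marked projective K3 surface `(S, η, p, x)` with an endomorphism `t` (rational,
type-preserving, killing `N¹`, image `⊥ N¹`, `P(t) = 0` on `T` for a separable `P` with `P(0) ≠ 0`,
generating `End_Hdg T(S)`) conjugate by a rational isometry `σ` of `Λ_ℚ` to `θ_ℂ` satisfies
`HodgeConjectureFor 4 (S ⊗ S)`: `θ` is self-adjoint (`selfAdjoint_of_zeta9Model`), `e₀ ≠ 0`, and
`hodgeConjectureFor_square_of_exists_on_open_at_of_isK3Surface` (rational orbit density + Buskin
transport) concludes. No located family is assumed here (the reusable `∀`-datum form). CONDITIONAL on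
`Buskin2019_hodgeIsometry_algebraic` and the displayed open-set input only; credits nothing.
[cite: GeemenSchutt2023, §2.1, §3.4, §4.8 and §5.6] [cite: Buskin2019, Thm. 1.1]
[cite: Huybrechts2016K3, Ch. 6 Prop. 1.5 and Ch. 14 §0.3 (vi)] -/
theorem hodgeConjectureFor_square_of_zeta9Model_of_open
    (hB : Buskin2019_hodgeIsometry_algebraic)
    {g : Module.End ℂ (K3Index → ℂ)} {y₀ : K3Index → ℂ} {θ : Matrix K3Index K3Index ℚ}
    (hZ : Zeta9Model[g, y₀, θ])
    {U : Set (K3Index → ℂ)} (hU : IsOpen U) {y₁ : K3Index → ℂ} (hy₁U : y₁ ∈ U)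
    (hy₁ : thetaC θ y₁ = ((2 * Real.cos (2 * Real.pi / 9) : ℝ) : ℂ) • y₁) (h₁₁ : k3Form y₁ y₁ = 0)
    (h₁p : 0 < (k3Form (star y₁) y₁).re) (hcyc : CycleEx[θ, (2 * Real.cos (2 * Real.pi / 9) : ℝ), U])
    {S : SchemeOver ℂ} (hS : IsK3Surface S) {P : ℚ[X]} (hPsep : P.Separable) (hP0 : P.eval 0 ≠ 0)
    (η : complexBetti S (2 * 1) ≃ₗ[ℂ] (K3Index → ℂ)) (p : complexBetti S (2 * 2)) (x : K3Index → ℂ)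
    (hM : MarkedK3[S, η, p, x])
    (t : complexBetti S (2 * 1) →ₗ[ℂ] complexBetti S (2 * 1))
    (ht_rat : ∀ y, IsRationalClass y → IsRationalClass (t y))
    (ht_typ : ∀ (i j : ℕ) (y : complexBetti S (2 * 1)),
      IsOfHodgeType 2 S (2 * 1) i j y → IsOfHodgeType 2 S (2 * 1) i j (t y))
    (ht_N : ∀ d ∈ algebraicClasses S 1, t d = 0)
    (ht_perp : ∀ (y : complexBetti S (2 * 1)), ∀ d ∈ algebraicClasses S 1,
      cupProduct (rfl : 2 * 1 + 2 * 1 = 2 * 2) (t y) d = 0)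
    (hP : IsAnnihilatedOnTranscendentalBy S t P) (hgen : TranscendentalEndomorphismsGeneratedBy S t)
    (σ : Module.End ℂ (K3Index → ℂ)) (hσ : ∀ a b, k3Form (σ a) (σ b) = k3Form a b)
    (hσrat : ∀ v : K3Index → ℤ, ∃ w : K3Index → ℚ, σ (fun i => (v i : ℂ)) = fun i => (w i : ℂ))
    (hconj : ∀ c : complexBetti S (2 * 1), σ (η (t c)) = thetaC θ (σ (η c))) :
    HodgeConjectureFor 4 (S ⊗ S) := by
  obtain ⟨hg, -, hg9, -, -, -, -, hθ⟩ := hZ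
  have hθsa : ∀ a b : K3Index → ℂ, k3Form (thetaC θ a) b = k3Form a (thetaC θ b) :=
    selfAdjoint_of_zeta9Model hg hg9 hθ
  have he₀ : (2 * Real.cos (2 * Real.pi / 9)) ≠ 0 := two_mul_cos_two_pi_div_nine_pos.ne'
  exact hodgeConjectureFor_square_of_exists_on_open_at_of_isK3Surface hB hθsa he₀ hU hy₁U hy₁ h₁₁ h₁p
    hcyc hS hPsep hP0 η p x hM t ht_rat ht_typ ht_N ht_perp hP hgen σ hσ hσrat hconj

/-- **HC⁴(S ⊗ S) for every K3 surface of the ζ₉ real-multiplication type (Picard number `10`, cubic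
real multiplication by `ℚ(ζ₉ + ζ₉⁻¹)`).** THERE IS a ζ₉ datum `(g, y₀, θ)` — an integral isometry `g`
of the K3 lattice of order dividing `9` with cube-fixed part of rank `10`, a period point `y₀` with
`g y₀ = e^{2πi/9} y₀`, and the model endomorphism `θ`, `θ_ℂ = ⅓(2g + 2g⁸ - g² - g⁴ - g⁵ - g⁷) =
(g + g⁻¹) ∘ P_T` (the cohomological action of `σ₀^* + (σ₀^*)⁻¹`, restricted to `T`, for the order-`9`
automorphism `σ₀ : t ↦ ζ₉t` of a very general member `y² = x³ + bx + c₁t⁹ + c₀` of the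
Artebani–Comparin–Valdés D2 family, the CM point of the van Geemen–Schütt ζ₉ family) — such that
EVERY projective K3 surface `S`, marked by `(η, p, x)` and carrying an endomorphism `t` of
`H²(S(ℂ); ℂ)` — rational, Hodge-type preserving, killing `N¹H²`, with image cup-orthogonal to `N¹H²`,
annihilated on `T(S)` by a separable `P ∈ ℚ[X]` with `P(0) ≠ 0`, and generating `End_Hdg T(S)` —
which is conjugate to `θ_ℂ` by a RATIONAL ISOMETRY `σ` of `Λ_ℚ` (`σ(η(t c)) = θ_ℂ(σ(η c))`),
satisfies `HodgeConjectureFor 4 (S ⊗ S)`. Proof: the fact supplies the datum together with an open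
`U ∋ y₁ ∈ D_{θ,e₀}`, `e₀ = 2cos(2π/9)`, and `CycleEx[θ, e₀, U]`;
`hodgeConjectureFor_square_of_zeta9Model_of_open` concludes. These `S` — all of Picard number `10`,
the first rational real-multiplication type INSIDE the open Picard list of crux `PicardThreeK3Squares`
settled by name — are exactly the K3 surfaces RM-isogenous to a member of the ζ₉ family
(`RMTypeOrbit.exists_isogenous_markedK3_mem_of_isOpen`). The `∃` over the datum reflects the ∃-form of
the fact (by Landherr's Hasse principle, not formalised, the rational type is unique anyway).
CONDITIONAL on `Buskin2019_hodgeIsometry_algebraic` and `VanGeemenSchuett2025_zeta9_cycleOnOpenPeriodSet`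
ONLY; credits nothing; HC is NOT proved here.
[cite: GeemenSchutt2023, Thm. 1.1 (9), §4.5, Prop. 4.6, §4.8, §5.6]
[cite: ArtebaniComparinValdes2020Order9, Thm. 1 (i), Prop. 2.2 and Example 3.5]
[cite: Buskin2019, Thm. 1.1] [cite: Huybrechts2016K3, Ch. 3 Cor. 3.6, Ch. 6 Prop. 1.5, Ch. 7 Thm. 5.3] -/
theorem exists_zeta9Type_hodgeConjectureFor_square
    (hB : Buskin2019_hodgeIsometry_algebraic) (hV : VanGeemenSchuett2025_zeta9_cycleOnOpenPeriodSet) :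
    ∃ (g : Module.End ℂ (K3Index → ℂ)) (y₀ : K3Index → ℂ) (θ : Matrix K3Index K3Index ℚ),
      Zeta9Model[g, y₀, θ] ∧ SquareHC[θ] := by
  obtain ⟨g, y₀, θ, hg, hgint, hg9, hfin, hy₀₀, hy₀p, hgy₀, hθ, U, hU, ⟨y₁, hy₁U, hy₁, h₁₁, h₁p⟩, hcyc⟩ :=
    hV
  refine ⟨g, y₀, θ, ⟨hg, hgint, hg9, hfin, hy₀₀, hy₀p, hgy₀, hθ⟩, ?_⟩
  intro S hS P hPsep hP0 η p x hM t ht_rat ht_typ ht_N ht_perp hP hgen σ hσ hσrat hconj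
  exact hodgeConjectureFor_square_of_zeta9Model_of_open hB ⟨hg, hgint, hg9, hfin, hy₀₀, hy₀p, hgy₀, hθ⟩
    hU hy₁U hy₁ h₁₁ h₁p hcyc hS hPsep hP0 η p x hM t ht_rat ht_typ ht_N ht_perp hP hgen σ hσ hσrat hconj

/-- **HC⁴ of every Hilbert square `S^{[2]}` of every K3 surface of the ζ₉ real-multiplication type**
(smooth projective fourfolds of K3^[2]-type with `ρ = 11`) — the datum of
`exists_zeta9Type_hodgeConjectureFor_square` followed by `HC⁴(S × S) ⇒ HC⁴(S^{[2]})`: `S^{[2]}` is the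
surjective image of the smooth blow-up of `S × S` along the diagonal
(`Beauville1983_hilbertSquare_blowupDiagonal_surjection`), so `hodgeConjectureFor_of_tower_surjective_le_five`
(pull-back input discharged by `fulton1998_map_mem_algebraicClasses_holds`) applies. CONDITIONAL on
`Buskin2019_hodgeIsometry_algebraic`, `VanGeemenSchuett2025_zeta9_cycleOnOpenPeriodSet` and
`Beauville1983_hilbertSquare_blowupDiagonal_surjection`; credits nothing; HC is NOT proved here.
[cite: GeemenSchutt2023, Thm. 1.1 (9), §4.8, §5.6] [cite: ArtebaniComparinValdes2020Order9, Example 3.5]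
[cite: Beauville1983, §6 (e)–(f), p. 766] [cite: Arapura2001HodgeCyclesModuli, Lemma 13 and Lemma 16]
[cite: Buskin2019, Thm. 1.1] -/
theorem exists_zeta9Type_hodgeConjectureFor_hilbertSquare
    (hB : Buskin2019_hodgeIsometry_algebraic) (hV : VanGeemenSchuett2025_zeta9_cycleOnOpenPeriodSet)
    (hBea : Beauville1983_hilbertSquare_blowupDiagonal_surjection) :
    ∃ (g : Module.End ℂ (K3Index → ℂ)) (y₀ : K3Index → ℂ) (θ : Matrix K3Index K3Index ℚ),
      Zeta9Model[g, y₀, θ] ∧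
      ∀ (S H : SchemeOver ℂ) (hS : IsK3Surface S) (Ξ : (S ⊗ H).left.IdealSheafData)
        (_hHilb : IsHilbertSchemeOfPoints 2 S H Ξ) (_hH : IsSmoothProjective 4 H)
        (P : ℚ[X]) (_hPsep : P.Separable) (_hP0 : P.eval 0 ≠ 0)
        (η : complexBetti S (2 * 1) ≃ₗ[ℂ] (K3Index → ℂ)) (p : complexBetti S (2 * 2)) (x : K3Index → ℂ)
        (_hM : MarkedK3[S, η, p, x])
        (t : complexBetti S (2 * 1) →ₗ[ℂ] complexBetti S (2 * 1))
        (_ht_rat : ∀ y, IsRationalClass y → IsRationalClass (t y))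
        (_ht_typ : ∀ (i j : ℕ) (y : complexBetti S (2 * 1)),
          IsOfHodgeType 2 S (2 * 1) i j y → IsOfHodgeType 2 S (2 * 1) i j (t y))
        (_ht_N : ∀ d ∈ algebraicClasses S 1, t d = 0)
        (_ht_perp : ∀ (y : complexBetti S (2 * 1)), ∀ d ∈ algebraicClasses S 1,
          cupProduct (rfl : 2 * 1 + 2 * 1 = 2 * 2) (t y) d = 0)
        (_hP : IsAnnihilatedOnTranscendentalBy S t P) (_hgen : TranscendentalEndomorphismsGeneratedBy S t)
        (σ : Module.End ℂ (K3Index → ℂ)) (_hσ : ∀ a b, k3Form (σ a) (σ b) = k3Form a b)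
        (_hσrat : ∀ v : K3Index → ℤ, ∃ w : K3Index → ℚ, σ (fun i => (v i : ℂ)) = fun i => (w i : ℂ))
        (_hconj : ∀ c : complexBetti S (2 * 1), σ (η (t c)) = thetaC θ (σ (η c))),
        HodgeConjectureFor 4 H := by
  obtain ⟨g, y₀, θ, hZ, hsq⟩ := exists_zeta9Type_hodgeConjectureFor_square hB hV
  refine ⟨g, y₀, θ, hZ, ?_⟩
  intro S H hS Ξ hHilb hH P hPsep hP0 η p x hM t ht_rat ht_typ ht_N ht_perp hP hgen σ hσ hσrat hconj
  have hS2 : IsSmoothProjective 2 S := hS.isSmoothProjective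
  obtain ⟨B, b, ρ, hBl, hρs⟩ := hBea S hS2 H Ξ hHilb
  haveI := hρs
  exact hodgeConjectureFor_of_tower_surjective_le_five fulton1998_map_mem_algebraicClasses_holds (n := 4)
    (by norm_num) (Relation.ReflTransGen.single (hBl.smoothBlowupStep (by norm_num))) hBl.top hH ρ
    (hsq S hS P hPsep hP0 η p x hM t ht_rat ht_typ ht_N ht_perp hP hgen σ hσ hσrat hconj)

/-- **The ζ₉ datum's own period lies on the Hodge locus `D_{θ,e₀}`: `θ_ℂ y₀ = 2cos(2π/9) · y₀`.**
Certifies the eigenvalue bookkeeping of the model endomorphism `θ_ℂ = ⅓(2g + 2g⁸ - g² - g⁴ - g⁵ - g⁷)`: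
on the `e^{2πi/9}`-eigenvector `y₀` of `g` it acts by `⅓(2ζ + 2ζ⁸ - ζ² - ζ⁴ - ζ⁵ - ζ⁷) = ζ + ζ⁻¹ =
2cos(2π/9)` (`ζ = e^{2πi/9}`; from `1 + ζ + ⋯ + ζ⁸ = 0` and `1 + ζ³ + ζ⁶ = 0`). Fact-free.
[cite: GeemenSchutt2023, §2.4 and §5.6] -/
theorem thetaC_apply_eq_of_zeta9Model {g : Module.End ℂ (K3Index → ℂ)} {y₀ : K3Index → ℂ}
    {θ : Matrix K3Index K3Index ℚ} (hZ : Zeta9Model[g, y₀, θ]) :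
    thetaC θ y₀ = ((2 * Real.cos (2 * Real.pi / 9) : ℝ) : ℂ) • y₀ := by
  obtain ⟨-, -, -, -, -, -, hgy₀, hθ⟩ := hZ
  set ζ : ℂ := Complex.exp (2 * Real.pi * Complex.I / 9) with hζdef
  have hζ : IsPrimitiveRoot ζ 9 := by
    simpa using Complex.isPrimitiveRoot_exp 9 (by norm_num)
  have hpow : ∀ k : ℕ, (g ^ k) y₀ = ζ ^ k • y₀ := by
    intro k
    induction k with
    | zero => simp
    | succ k ih =>
      rw [pow_succ', Module.End.mul_apply, ih, map_smul, hgy₀, smul_smul, pow_succ, mul_comm]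
  have hS9 := hζ.geom_sum_eq_zero (by norm_num : 1 < 9)
  have hζ3 : IsPrimitiveRoot (ζ ^ 3) 3 := hζ.pow (by norm_num) (by norm_num)
  have hS3 := hζ3.geom_sum_eq_zero (by norm_num : 1 < 3)
  simp only [Finset.sum_range_succ, Finset.sum_range_zero, zero_add, pow_zero, pow_one, ← pow_mul]
    at hS9 hS3
  norm_num at hS3
  have hkey : (1 / 3 : ℂ) * (2 * ζ + 2 * ζ ^ 8 - ζ ^ 2 - ζ ^ 4 - ζ ^ 5 - ζ ^ 7) = ζ + ζ ^ 8 := by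
    linear_combination (-1 / 3 : ℂ) * hS9 + (1 / 3 : ℂ) * hS3
  have h8 : ζ ^ 8 = ζ⁻¹ := by
    have h9 : ζ ^ 9 = 1 := hζ.pow_eq_one
    exact eq_inv_of_mul_eq_one_left (by rw [← pow_succ, h9])
  have hcos : ((2 * Real.cos (2 * Real.pi / 9) : ℝ) : ℂ) = ζ + ζ ^ 8 := by
    rw [h8, hζdef, ← Complex.exp_neg]
    push_cast
    rw [Complex.two_cos]
    congr 1 <;> congr 1 <;> ring
  rw [hθ y₀, hpow 8, hpow 2, hpow 4, hpow 5, hpow 7, hgy₀, hcos, ← hkey]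
  simp only [smul_smul, ← sub_smul, ← add_smul]

/-- `2cos(2π/9)` is a root of `X³ - 3X + 1` — the polynomial `P` of the tree fact
`VanGeemenSchuett2025_rmK3_cycleInduced_zeta9` (`IsCycleInducedRMK3 S 10 (X³ - 3X + 1)`), the minimal
polynomial of `ζ₉ + ζ₉⁻¹`: the `(2,0)`-eigenvalue `e₀` of the ζ₉ model endomorphism generates the cubic
field `ℚ(ζ₉ + ζ₉⁻¹)`. From `cos 3x = 4cos³x - 3cos x` at `x = 2π/9` and `cos(2π/3) = -½`. Fact-free.
[cite: GeemenSchutt2023, Thm. 1.1 (9)] -/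
theorem aeval_two_mul_cos_two_pi_div_nine_eq_zero :
    Polynomial.aeval (2 * Real.cos (2 * Real.pi / 9)) (X ^ 3 - 3 * X + 1 : ℚ[X]) = 0 := by
  have h3 : Real.cos (3 * (2 * Real.pi / 9)) =
      4 * Real.cos (2 * Real.pi / 9) ^ 3 - 3 * Real.cos (2 * Real.pi / 9) := Real.cos_three_mul _
  have h23 : Real.cos (3 * (2 * Real.pi / 9)) = -1 / 2 := by
    rw [show 3 * (2 * Real.pi / 9) = Real.pi - Real.pi / 3 by ring, Real.cos_pi_sub, Real.cos_pi_div_three]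
    norm_num
  simp only [map_add, map_sub, map_mul, map_pow, Polynomial.aeval_X, map_one, map_ofNat]
  linear_combination (-2 : ℝ) * h3 + 2 * h23

end Summit.HodgeConjecture.HodgeConjecture.Theorems.MarkmanPartnerTransport.RMTypeOrbit

end
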